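import Summits.BirchSwinnertonDyer.BirchSwinnertonDyer.Theorems.CyclotomicUntwistMahlerTail
import Summits.BirchSwinnertonDyer.BirchSwinnertonDyer.Theorems.CyclotomicUntwistUntwistedNonvanishingUnconditional
import Literature.NumberTheory.IwasawaTheory.PSFiniteSlopeSelmer
import HarnessLib

/-!
# Amice injectivity for order `< 1`: the Amice transform of non-zero additive ball values of growth
# order `ν < 1` is not the zero power series — so D1's `𝓛^η_W(T) ≠ 0`, unconditionally

Cell `pub/bsd-wall` (D-0145 line `route-BirchSwinnertonDyer-CyclotomicUntwist`), seat `bsd-line-cycu-p1`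
(prover seat 1/3), helper toward crux K1 `PSRankOneLowerHalfAtThree` (stmt-BirchSwinnertonDyer-21580), D1
currency (`Literature.NumberTheory.IwasawaTheory.PSCyclotomicLFunction`, §Amice).  Second of two files
(`CyclotomicUntwistMahlerTail`, this).  THEOREMS ONLY (no definition, no named fact, no `sorry`); BSD is
not proved by this file and no crux is.

D1 attaches to additive ball values `μ` on `Γ` of growth order `ν < 1` the Mahler coefficients
`c_k = ∫_Γ binom(ℓ, k) dμ` (limits of Riemann sums, `gammaMahlerCoeff`) and the Amice transform
`L_μ(T) = ∑ c_k T^k` (`gammaAmiceTransform`).  Sibling seat cycu-p5 proved that the route's object has a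
non-zero BALL VALUE (`PSUntwistNonvanishingUnconditional.exists_apply_ne_zero_of_isPSCyclotomicLFunctionOf'`)
and listed «`gammaAmiceTransform ≠ 0` (needs the `C^ν` Amice bound, not the Lipschitz API)» as not done.
This file proves it inside the Lipschitz API:

* `eq_zero_of_forall_gammaMahlerCoeff_eq_zero` — if all `c_k = 0` then all ball values vanish: with
  `e_k = Δ^k 𝟙_{s+pⁿℤ}(0) ∈ ℤ` and `P_K = ∑_{k≤K} e_k binom(·,k)`, the Riemann sums of `P_K` tend to
  `∑ e_k c_k = 0`, those of `𝟙_{ball}` are `μ(n,s)`, and the tail `𝟙_{ball} − P_K = ∑_{k>K} e_k binom(·,k)`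
  (pointwise finite on `ℕ`) has sup-norm and Lipschitz constant `≤ sup_{k>K} k‖e_k‖ → 0` by the sharp
  Lipschitz constant `k p^{-m}` of `binom(·,k)` and the decay `‖e_k‖ ≤ p^{1−(k+1)/pⁿ}` of
  `CyclotomicUntwistMahlerTail`; hence `‖μ(n,s)‖ ≤ max(εC, εC p^ν)` for every `ε > 0`.
* `gammaAmiceTransform_ne_zero` — the contrapositive: **`L_μ ≠ 0` for non-zero additive `μ` of order `< 1`**.
* `gammaAmiceTransform_ne_zero_of_isUntwistedPAdicLFunction` (newform of any `E/ℚ`, any `p`, `η`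
  primitive mod `p^c`, `c ≥ 1`, `α ≠ 0`) and `gammaAmiceTransform_ne_zero_of_isPSCyclotomicLFunctionOf` —
  **the route's power series `𝓛^η_W(T) ∈ ℂ₃⟦T⟧` is not zero on every Pollack–Stevens row**, unconditionally
  (ball value from cycu-p5's theorem, additivity and order `½` from D1).
* §6 `gammaOrderAtOne_lt_top`, `gammaLeadingCoeff_ne_zero`, `gammaOrderAtOne_lt_top_of_isPSCyclotomicLFunctionOf`
  — hence D3's order of vanishing at `𝟙` (`gammaOrderAtOne`, a `PowerSeries.order`) is FINITE and the
  leading coefficient `gammaLeadingCoeff` is NON-ZERO on every such row: the two quantities of the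
  rank-one reading of K1/K2 are honest numbers, not junk values.

References: [cite: MazurTateTeitelbaum1986Invent, §I.11 and §I.13]; [cite: Bellaiche2021, Thm. 6.2.13];
[cite: Kobayashi2013, Thm. 2.5 (proof, p. 547)].
-/

noncomputable section

open Finset Filter Topology Literature.NumberTheory.IwasawaTheory
  Summit.BirchSwinnertonDyer.BirchSwinnertonDyer.Theorems.PSMahlerTail
open Summit.BirchSwinnertonDyer.Rank1Residual.X11b.UnrUnits (norm_natCast_le_one)

-- single-conjunct summit: `Summit.BirchSwinnertonDyer.BirchSwinnertonDyer.…` repeats the name by design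
set_option linter.dupNamespace false
set_option autoImplicit false

namespace Summit.BirchSwinnertonDyer.BirchSwinnertonDyer.Theorems.PSAmiceInjective

variable {p : ℕ} [hp : Fact p.Prime]

/-! ### §4 Amice injectivity for order `< 1` -/

section Main

variable {μ : (n : ℕ) → ZMod (p ^ n) → ℂ_[p]}

/-- The decay rate `(k+1) · p^{1 − (k+1)/pⁿ} → 0` (`= p · (k+1) rᵏ⁺¹` with `r = p^{-1/pⁿ} < 1`). [folklore] -/
theorem tendsto_succ_mul_rpow (n : ℕ) :
    Tendsto (fun k : ℕ ↦ ((k : ℝ) + 1) * (p : ℝ) ^ (1 - ((k : ℝ) + 1) / (p ^ n : ℕ))) atTop (𝓝 0) := by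
  have hpr : (1 : ℝ) < p := by exact_mod_cast hp.out.one_lt
  have hp0 : (0 : ℝ) < p := by linarith
  have hN : (0 : ℝ) < ((p ^ n : ℕ) : ℝ) := by exact_mod_cast pow_pos hp.out.pos n
  set r : ℝ := (p : ℝ) ^ (-(1 : ℝ) / (p ^ n : ℕ)) with hr
  have hr0 : 0 ≤ r := (Real.rpow_pos_of_pos hp0 _).le
  have hr1 : r < 1 := Real.rpow_lt_one_of_one_lt_of_neg hpr (by
    rw [neg_div]; exact neg_neg_of_pos (div_pos one_pos hN))
  have hlim := ((tendsto_self_mul_const_pow_of_lt_one hr0 hr1).comp (tendsto_add_atTop_nat 1)).const_mul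
    (p : ℝ)
  rw [mul_zero] at hlim
  refine hlim.congr fun k ↦ ?_
  simp only [Function.comp_apply, hr]
  rw [← Real.rpow_natCast ((p : ℝ) ^ (-(1 : ℝ) / (p ^ n : ℕ))) (k + 1), ← Real.rpow_mul hp0.le,
    show (1 : ℝ) - ((k : ℝ) + 1) / (p ^ n : ℕ) = 1 + -(1 : ℝ) / (p ^ n : ℕ) * ((k + 1 : ℕ) : ℝ) by
      push_cast; ring,
    Real.rpow_add hp0, Real.rpow_one]
  push_cast
  ring

/-- **Amice injectivity for order `< 1`.** Let `μ` be additive ball values on `Γ` of growth order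
`ν < 1` (`IsGammaDistribution`, `HasGrowthOrder`). If every Mahler coefficient
`c_k = ∫_Γ binom(ℓ, k) dμ` vanishes, then every ball value vanishes. Proof: with `e_k = Δ^k 𝟙_{s+pⁿℤ}(0) ∈ ℤ`
and `P_K = ∑_{k≤K} e_k binom(·,k)`, the Riemann sums of `P_K` tend to `∑_{k≤K} e_k c_k = 0`
(`tendsto_gammaRiemannSum_gammaMahlerCoeff`), those of `𝟙_{ball}` are `μ(n,s)` from level `n` on, and the
tail `𝟙_{ball} − P_K = ∑_{k>K} e_k binom(·,k)` (Gregory–Newton, pointwise finite on `ℕ`) has sup-norm and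
Lipschitz constant `≤ sup_{k>K} k‖e_k‖ ≤ ε` for `K` large (§1–§2), so `‖μ(n,s)‖ ≤ max(εC, εC p^ν)` for every
`ε > 0` (§3). [cite: Bellaiche2021, Thm. 6.2.13] [cite: MazurTateTeitelbaum1986Invent, §I.11 and §I.13] -/
theorem eq_zero_of_forall_gammaMahlerCoeff_eq_zero (hμ : IsGammaDistribution p μ) {ν : ℝ}
    (hν : HasGrowthOrder p ν μ) (hν1 : ν < 1) (h0 : ∀ k, gammaMahlerCoeff p μ k = 0)
    (n : ℕ) (s : ZMod (p ^ n)) : μ n s = 0 := by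
  have hpr : (1 : ℝ) < p := by exact_mod_cast hp.out.one_lt
  have hp0 : (0 : ℝ) < p := by linarith
  -- normalise the order to `ν' = max ν 0 ∈ [0, 1)`
  have hν' : HasGrowthOrder p (max ν 0) μ := hν.mono (le_max_left _ _)
  have hν'1 : max ν 0 < 1 := max_lt hν1 one_pos
  have hν'0 : 0 ≤ max ν 0 := le_max_right _ _
  obtain ⟨C, hC⟩ := hν'
  have hC0 : 0 ≤ C := by
    have h := hC 0 0
    simp only [CharP.cast_eq_zero, mul_zero, Real.rpow_zero, mul_one] at h
    exact (norm_nonneg _).trans h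
  haveI : NeZero (p ^ n) := ⟨pow_ne_zero _ hp.out.ne_zero⟩
  -- the indicator of the ball and its integer Mahler coefficients
  set φℤ : ℕ → ℤ := fun a ↦ if (a : ZMod (p ^ n)) = s then 1 else 0 with hφℤ
  have hper : ∀ a, φℤ (a + p ^ n) = φℤ a := by
    intro a
    simp only [hφℤ]
    rw [Nat.cast_add, ZMod.natCast_self, add_zero]
  set e : ℕ → ℤ := fun k ↦ (fwdDiff (1 : ℕ))^[k] φℤ 0 with he
  have hdecay : ∀ k, ‖(e k : ℂ_[p])‖ ≤ (p : ℝ) ^ (1 - ((k : ℝ) + 1) / (p ^ n : ℕ)) := fun k ↦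
    norm_fwdDiff_iter_le_of_periodic φℤ hper k
  -- the indicator as a `ℂ_p`-valued integrand, and the Mahler partial sums `P_K`
  set φ : ℕ → ℂ_[p] := fun a ↦ ((φℤ a : ℤ) : ℂ_[p]) with hφ
  have hφind : φ = fun a : ℕ ↦ if (a : ZMod (p ^ n)) = s then (1 : ℂ_[p]) else 0 := by
    funext a
    simp only [hφ, hφℤ]
    split_ifs <;> simp
  set P : ℕ → ℕ → ℂ_[p] := fun K a ↦
    ∑ k ∈ range (K + 1), (e k : ℂ_[p]) * ((a.choose k : ℕ) : ℂ_[p]) with hP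
  -- (1) Riemann sums of the indicator are `μ n s`
  have hRSφ : ∀ m, n ≤ m → gammaRiemannSum p μ φ m = μ n s := fun m hm ↦ by
    rw [hφind]; exact gammaRiemannSum_indicator hμ s hm
  -- (2) Riemann sums of `P_K` tend to `∑ e_k c_k = 0`
  have hRSP : ∀ K, Tendsto (gammaRiemannSum p μ (P K)) atTop (𝓝 0) := by
    intro K
    have h := tendsto_finsetSum (range (K + 1)) fun k _ ↦
      (tendsto_gammaRiemannSum_gammaMahlerCoeff hμ hν hν1 k).const_mul (e k : ℂ_[p])
    simp only [h0, mul_zero, Finset.sum_const_zero] at h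
    refine h.congr fun m ↦ ?_
    exact (gammaRiemannSum_finset_sum μ _ _ _ m).symm
  -- (3) the tail representation `φ − P_K = ∑_{K < k < M} e_k binom(·,k)` on `[0, M)`
  have htail : ∀ K a M, a < M → φ a - P K a =
      ∑ k ∈ range M \ range (K + 1), (e k : ℂ_[p]) * ((a.choose k : ℕ) : ℂ_[p]) := by
    intro K a M haM
    have h1 : φ a = ∑ k ∈ range M, (e k : ℂ_[p]) * ((a.choose k : ℕ) : ℂ_[p]) := by
      simp only [hφ, he]
      rw [eq_sum_range_choose_mul_fwdDiff φℤ haM]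
      push_cast
      exact Finset.sum_congr rfl fun k _ ↦ mul_comm _ _
    have h2 : P K a = ∑ k ∈ range M ∩ range (K + 1), (e k : ℂ_[p]) * ((a.choose k : ℕ) : ℂ_[p]) := by
      simp only [hP]
      refine (Finset.sum_subset Finset.inter_subset_right fun k hk hk' ↦ ?_).symm
      have hkM : ¬ k ∈ range M := fun h ↦ hk' (Finset.mem_inter.2 ⟨h, hk⟩)
      rw [Finset.mem_range, not_lt] at hkM
      rw [Nat.choose_eq_zero_of_lt (by omega), Nat.cast_zero, mul_zero]
    rw [h1, h2, ← Finset.sum_sdiff (Finset.inter_subset_left (s₁ := range M) (s₂ := range (K + 1))),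
      add_sub_cancel_right, Finset.sdiff_inter_self_left]
  -- (4) for every `ε > 0`: `‖μ n s‖ ≤ max (ε C) (ε C p^ν')`
  have hmain : ∀ ε : ℝ, 0 < ε → ‖μ n s‖ ≤ max (ε * C) (ε * C * (p : ℝ) ^ (max ν 0)) := by
    intro ε hε
    -- choose `K`: for `k > K`, `‖e_k‖ ≤ ε` and `k ‖e_k‖ ≤ ε`
    obtain ⟨K, hK⟩ : ∃ K : ℕ, ∀ k, K ≤ k →
        ((k : ℝ) + 1) * (p : ℝ) ^ (1 - ((k : ℝ) + 1) / (p ^ n : ℕ)) < ε :=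
      eventually_atTop.1 ((tendsto_succ_mul_rpow (p := p) n).eventually (gt_mem_nhds hε))
    have hek : ∀ k, K < k → ‖(e k : ℂ_[p])‖ ≤ ε ∧ (k : ℝ) * ‖(e k : ℂ_[p])‖ ≤ ε := by
      intro k hk
      have h1 := hdecay k
      have h2 := (hK k hk.le).le
      have hq : 0 ≤ (p : ℝ) ^ (1 - ((k : ℝ) + 1) / (p ^ n : ℕ)) := (Real.rpow_pos_of_pos hp0 _).le
      have hk0 : (0 : ℝ) ≤ k := Nat.cast_nonneg k
      constructor
      · nlinarith
      · nlinarith [mul_le_mul_of_nonneg_left h1 hk0]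
    -- sup bound of the tail
    have hsup : ∀ a, ‖φ a - P K a‖ ≤ ε := by
      intro a
      rw [htail K a (a + 1) (Nat.lt_succ_self a)]
      refine IsUltrametricDist.norm_sum_le_of_forall_le_of_nonneg hε.le fun k hk ↦ ?_
      have hKk : K < k := by
        simp only [Finset.mem_sdiff, Finset.mem_range, not_lt] at hk; omega
      rw [norm_mul]
      exact (mul_le_mul (hek k hKk).1 (norm_natCast_le_one _) (norm_nonneg _) hε.le).trans
        (le_of_eq (mul_one _))
    -- Lipschitz constant of the tail
    have hlip : IsPadicLipschitz p ε (fun a ↦ φ a - P K a) := by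
      intro j a b hab
      dsimp only
      set M := max a b + 1 with hM
      rw [htail K a M (by omega), htail K b M (by omega), ← Finset.sum_sub_distrib]
      refine IsUltrametricDist.norm_sum_le_of_forall_le_of_nonneg (by positivity) fun k hk ↦ ?_
      have hKk : K < k := by
        simp only [Finset.mem_sdiff, Finset.mem_range, not_lt] at hk; omega
      rw [← mul_sub, norm_mul]
      calc ‖(e k : ℂ_[p])‖ * ‖((a.choose k : ℕ) : ℂ_[p]) - ((b.choose k : ℕ) : ℂ_[p])‖
          ≤ ‖(e k : ℂ_[p])‖ * ((k : ℝ) * ((p : ℝ) ^ j)⁻¹) :=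
            mul_le_mul_of_nonneg_left (norm_choose_sub_choose_le hab k) (norm_nonneg _)
        _ = ((k : ℝ) * ‖(e k : ℂ_[p])‖) * ((p : ℝ) ^ j)⁻¹ := by ring
        _ ≤ ε * ((p : ℝ) ^ j)⁻¹ := mul_le_mul_of_nonneg_right (hek k hKk).2 (by positivity)
    -- Riemann sums of the tail, uniformly in the level `m ≥ n`
    have hRS : ∀ m, n ≤ m →
        ‖μ n s - gammaRiemannSum p μ (P K) m‖ ≤ max (ε * C) (ε * C * (p : ℝ) ^ (max ν 0)) := by
      intro m hm
      rw [← hRSφ m hm, ← gammaRiemannSum_sub]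
      exact norm_gammaRiemannSum_le hμ hC hν'1.le hε.le hε.le hsup hlip m
    -- let `m → ∞`
    have hlim : Tendsto (fun m ↦ ‖μ n s - gammaRiemannSum p μ (P K) m‖) atTop (𝓝 ‖μ n s - 0‖) :=
      (tendsto_const_nhds.sub (hRSP K)).norm
    rw [sub_zero] at hlim
    exact le_of_tendsto hlim (eventually_atTop.2 ⟨n, hRS⟩)
  -- (5) conclude
  by_contra hne
  have hpos : 0 < ‖μ n s‖ := norm_pos_iff.2 hne
  set M : ℝ := C + C * (p : ℝ) ^ (max ν 0) with hM
  have hM0 : 0 ≤ M := by positivity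
  have h := hmain (‖μ n s‖ / (2 * (M + 1))) (by positivity)
  have hmax : max (‖μ n s‖ / (2 * (M + 1)) * C) (‖μ n s‖ / (2 * (M + 1)) * C * (p : ℝ) ^ (max ν 0)) ≤
      ‖μ n s‖ / (2 * (M + 1)) * M := by
    have hε0 : 0 ≤ ‖μ n s‖ / (2 * (M + 1)) := by positivity
    refine max_le ?_ ?_
    · refine mul_le_mul_of_nonneg_left ?_ hε0
      rw [hM]; nlinarith [Real.rpow_pos_of_pos hp0 (max ν 0)]
    · rw [mul_assoc]
      refine mul_le_mul_of_nonneg_left ?_ hε0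
      rw [hM]; nlinarith
  have hlt : ‖μ n s‖ / (2 * (M + 1)) * M < ‖μ n s‖ := by
    rw [div_mul_eq_mul_div, div_lt_iff₀ (by positivity)]
    nlinarith
  linarith [h.trans hmax]

/-- **The Amice transform of non-zero additive ball values of order `< 1` is not zero**
(`gammaAmiceTransform`, D1 §Amice; contrapositive of `eq_zero_of_forall_gammaMahlerCoeff_eq_zero`).
[cite: Bellaiche2021, Thm. 6.2.13] [cite: MazurTateTeitelbaum1986Invent, §I.13] -/
theorem gammaAmiceTransform_ne_zero (hμ : IsGammaDistribution p μ) {ν : ℝ}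
    (hν : HasGrowthOrder p ν μ) (hν1 : ν < 1) (h : ∃ (n : ℕ) (s : ZMod (p ^ n)), μ n s ≠ 0) :
    gammaAmiceTransform p μ ≠ 0 := by
  obtain ⟨n, s, hs⟩ := h
  intro H
  refine hs (eq_zero_of_forall_gammaMahlerCoeff_eq_zero hμ hν hν1 (fun k ↦ ?_) n s)
  have := congrArg (PowerSeries.coeff k) H
  simpa using this

end Main

/-! ### §5 The untwisted `p`-adic `L`-function of an elliptic curve, as a power series, is not zero -/

section Curve

open Literature.NumberTheory.EllipticCurves Literature.NumberTheory.EllipticCurves.ModularForms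
  Summit.BirchSwinnertonDyer.BirchSwinnertonDyer.Theorems.PSUntwistNonvanishingUnconditional

open scoped MatrixGroups

/-- **`L_μ(T) ≠ 0` for the untwisted `p`-adic `L`-function of an elliptic curve** (any prime `p`,
`η` primitive mod `p^c`, `c ≥ 1`, `α ≠ 0`): `IsUntwistedPAdicLFunction p f η α μ` for the newform `f` of
`W/ℚ` gives additivity and order `½ < 1` (D1), a non-zero ball value
(`PSUntwistNonvanishingUnconditional.exists_apply_ne_zero`, cycu-p5), hence a non-zero Amice transform
(`gammaAmiceTransform_ne_zero`). [cite: MazurTateTeitelbaum1986Invent, §I.13 and §I.14] -/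
theorem gammaAmiceTransform_ne_zero_of_isUntwistedPAdicLFunction {N : ℕ} [NeZero N]
    {f : CuspForm (CongruenceSubgroup.Gamma0 N) 2} {c : ℕ} {η : DirichletCharacter ℂ_[p] (p ^ c)}
    {α : ℂ_[p]} {μ : (n : ℕ) → ZMod (p ^ n) → ℂ_[p]} {W : WeierstrassCurve ℚ} [W.IsElliptic]
    (hμ : IsUntwistedPAdicLFunction p f η α μ) (hc : 0 < c) (hη : η.IsPrimitive) (hα : α ≠ 0)
    (hf : IsNewformOf W f) : gammaAmiceTransform p μ ≠ 0 :=
  gammaAmiceTransform_ne_zero hμ.isGammaDistribution hμ.hasGrowthOrder (by norm_num)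
    (exists_apply_ne_zero hμ hc hη hα hf)

/-- **The route's power series `𝓛^η_W(T) ∈ ℂ₃⟦T⟧` is not zero** on every row where D1's object exists:
`IsPSCyclotomicLFunctionOf W η α μ` with `η` primitive mod `9` and `α ≠ 0` implies
`gammaAmiceTransform 3 μ ≠ 0` (Pollack–Stevens rows of K1/K2 included, `3 ∣ N`) — unconditionally.
[cite: MazurTateTeitelbaum1986Invent, §I.13 and §I.14] -/
theorem gammaAmiceTransform_ne_zero_of_isPSCyclotomicLFunctionOf {W : WeierstrassCurve ℚ}
    [W.IsElliptic] {η : DirichletCharacter ℂ_[3] (3 ^ 2)} {α : ℂ_[3]}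
    {μ : (n : ℕ) → ZMod (3 ^ n) → ℂ_[3]} (hμ : IsPSCyclotomicLFunctionOf W η α μ)
    (hη : η.IsPrimitive) (hα : α ≠ 0) : gammaAmiceTransform 3 μ ≠ 0 := by
  obtain ⟨hadd, hgr⟩ := hμ.isGammaDistribution_and_hasGrowthOrder
  exact gammaAmiceTransform_ne_zero hadd hgr (by norm_num)
    (exists_apply_ne_zero_of_isPSCyclotomicLFunctionOf' hμ hη hα)

end Curve

/-! ### §6 Consequently the order of vanishing at `𝟙` is finite and the leading coefficient is non-zero -/

section Order

variable {μ : (n : ℕ) → ZMod (p ^ n) → ℂ_[p]}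

/-- **Finite order of vanishing at the trivial character**: for non-zero additive ball values of order
`< 1`, `gammaOrderAtOne p μ = ord_{T=0} L_μ(T) < ⊤` (D3's `gammaOrderAtOne` is the `PowerSeries.order` of
the Amice transform; Mathlib `PowerSeries.order_finite_iff_ne_zero`). [cite: Bellaiche2021, Thm. 6.2.13]
[cite: MazurTateTeitelbaum1986Invent, §I.13] -/
theorem gammaOrderAtOne_lt_top (hμ : IsGammaDistribution p μ) {ν : ℝ} (hν : HasGrowthOrder p ν μ)
    (hν1 : ν < 1) (h : ∃ (n : ℕ) (s : ZMod (p ^ n)), μ n s ≠ 0) : gammaOrderAtOne p μ < ⊤ :=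
  PowerSeries.order_finite_iff_ne_zero.2 (gammaAmiceTransform_ne_zero hμ hν hν1 h)

/-- **Non-zero leading coefficient at the trivial character**: for non-zero additive ball values of
order `< 1`, `gammaLeadingCoeff p μ ≠ 0` (the coefficient of `T^{ord}` of a non-zero power series,
Mathlib `PowerSeries.coeff_order`). [cite: Bellaiche2021, Thm. 6.2.13] [cite: MazurTateTeitelbaum1986Invent, §I.13] -/
theorem gammaLeadingCoeff_ne_zero (hμ : IsGammaDistribution p μ) {ν : ℝ} (hν : HasGrowthOrder p ν μ)
    (hν1 : ν < 1) (h : ∃ (n : ℕ) (s : ZMod (p ^ n)), μ n s ≠ 0) : gammaLeadingCoeff p μ ≠ 0 :=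
  PowerSeries.coeff_order (gammaAmiceTransform_ne_zero hμ hν hν1 h)

open Literature.NumberTheory.EllipticCurves
  Summit.BirchSwinnertonDyer.BirchSwinnertonDyer.Theorems.PSUntwistNonvanishingUnconditional in
/-- **On every Pollack–Stevens row the order of vanishing of `𝓛^η_W` at `𝟙` is a natural number and its
leading coefficient is non-zero** — the two quantities the rank-one reading of K1/K2 speaks about
(`gammaOrderAtOne`, `gammaLeadingCoeff` of D3) are honest, unconditionally: `IsPSCyclotomicLFunctionOf W η α μ`,
`η` primitive, `α ≠ 0` ⟹ `gammaOrderAtOne 3 μ < ⊤ ∧ gammaLeadingCoeff 3 μ ≠ 0`.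
[cite: MazurTateTeitelbaum1986Invent, §I.13 and §I.14] -/
theorem gammaOrderAtOne_lt_top_of_isPSCyclotomicLFunctionOf {W : WeierstrassCurve ℚ} [W.IsElliptic]
    {η : DirichletCharacter ℂ_[3] (3 ^ 2)} {α : ℂ_[3]} {μ : (n : ℕ) → ZMod (3 ^ n) → ℂ_[3]}
    (hμ : IsPSCyclotomicLFunctionOf W η α μ) (hη : η.IsPrimitive) (hα : α ≠ 0) :
    gammaOrderAtOne 3 μ < ⊤ ∧ gammaLeadingCoeff 3 μ ≠ 0 := by
  obtain ⟨hadd, hgr⟩ := hμ.isGammaDistribution_and_hasGrowthOrder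
  have h := exists_apply_ne_zero_of_isPSCyclotomicLFunctionOf' hμ hη hα
  exact ⟨gammaOrderAtOne_lt_top hadd hgr (by norm_num) h,
    gammaLeadingCoeff_ne_zero hadd hgr (by norm_num) h⟩

end Order


end Summit.BirchSwinnertonDyer.BirchSwinnertonDyer.Theorems.PSAmiceInjective

end
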